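import Literature.Geometry.Kaehler.RiemannSurfaceChevalleyWeilMultiplicities
import Literature.RepresentationTheory.FiniteGroups.CharacterSymmetricSquare
import HarnessLib

/-!
# `N = dim (S²𝓗¹(M))^G = (2|G|)⁻¹ Σ_{x ∈ G} (χ(x²) + χ(x)²)` — the invariants of `G ≤ Aut M` in the symmetric
# square of the holomorphic differentials (Frediani–Ghigi–Penegini (2.4), (2.5), (4.1))

Layer `Literature/Geometry/Kaehler`, sequel of `RiemannSurfaceChevalleyWeilMultiplicities` (the restricted
representation `𝓗¹(M)|_G = (oneFormRep M).comp G.subtype`, `χ(h) = tr(h|𝓗¹(M))`, `χ(h⁻¹) = conj χ(h)`) and of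
`Literature.RepresentationTheory.FiniteGroups.CharacterSymmetricSquare` (lane row g11-#1: the symmetric and
antisymmetric squares `Representation.symmSq ρ`, `Representation.altSq ρ` on `S(V ⊗ V)`, `A(V ⊗ V)` and
James–Liebeck 19.14 `χ_S(g) = ½(χ(g)² + χ(g²))`, `χ_A(g) = ½(χ(g)² − χ(g²))`).
P. Frediani, A. Ghigi, M. Penegini, *Shimura varieties in the Torelli locus via Galois coverings*, IMRN 2015,
as printed (arXiv:1402.0973, p. 3 and p. 14, §4 p. 21), for a `G`-Galois cover `C → C/G`,
`ρ : G → GL(H⁰(C, K_C))`: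

> `N := dim(S² H⁰(C, K_C))^G`
> 2.11. Let `σ : G → GL(V)` be any linear representation of `G` with character `χ_σ`. Denote by `S²σ` the
> induced representation on `S²V` and by `χ_{S²σ}` its character. Then for `x ∈ G`
> (2.4) `χ_{S²σ}(x) = ½(χ_σ(x)² + χ_σ(x²))`. (See e.g. [40, Proposition 3]).
> 2.12. We are only interested in the multiplicity `N` of the trivial representation inside `S²ρ`. […] Using
> the orthogonality relations and (2.4), `N` can be computed as follows:
> (2.5) `N = (χ_{S²ρ}, 1) = |G|⁻¹ Σ_{x ∈ G} χ_{S²ρ}(x) = (2|G|)⁻¹ Σ_{x ∈ G} (χ_ρ(x²) + χ_ρ(x)²)`.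
> (p. 21) The following observation simplifies the computation of `N`. Denote by `G₀` the set of elements of
> order `2` in `G`. The set of elements of order greater than `2` can be written as `G₁ ⊔ G₁⁻¹` for some choice
> of `G₁ ⊆ G`. Then (2.5) becomes
> (4.1) `N = (χ_ρ(1) + χ_ρ(1)²)/(2|G|) + (2|G|)⁻¹ Σ_{x ∈ G₀} (χ_ρ(x²) + χ_ρ(x)²)
>   + (2|G|)⁻¹ Σ_{x ∈ G₁} (χ_ρ(x²) + χ_ρ(x)²) + (2|G|)⁻¹ Σ_{x ∈ G₁} (χ_ρ(x⁻²) + χ_ρ(x⁻¹)²)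
>   = (g + g² + |G₀|g)/(2|G|) + (2|G|)⁻¹ Σ_{x ∈ G₀} χ_ρ(x)² + |G|⁻¹ Σ_{x ∈ G₁} Re(χ_ρ(x²) + χ_ρ(x)²)`.

Here `N` is `finrank ℂ (Representation.symmSq 𝓗¹(M)|_G).invariants`, the dimension of the `G`-invariant symmetric
tensors in `𝓗¹(M) ⊗ 𝓗¹(M)`; «`(χ_{S²ρ}, 1) = |G|⁻¹ Σ_x χ_{S²ρ}(x)` is the multiplicity of the trivial
representation» is Mathlib's `Representation.card_inv_mul_sum_char_eq_finrank`. The number `N` is the dimension of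
`(S² H^{1,0})^G`, i.e. of the `G`-fixed locus of Siegel space at the Jacobian (Lemma 3.8 there); that reading is
not formalised here.

## What is proved (no definitions, no named facts, no instances)

* §1 (any finite group `G`, any finite-dimensional complex `V`) **`two_mul_card_mul_finrank_invariants_symmSq`**
  (`2|G|·dim(S²V)^G = Σ_x (χ(x)² + χ(x²))`, (2.4)–(2.5) for every `σ`),
  `two_mul_card_mul_finrank_invariants_altSq` (`2|G|·dim(Λ²V)^G = Σ_x (χ(x)² − χ(x²))`),
  `card_mul_finrank_invariants_symmSq_sub_eq` (`|G|·(dim(S²V)^G − dim(Λ²V)^G) = Σ_x χ(x²)`),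
  `trace_sq_add_trace_sq_inv` (`χ(x⁻²) + χ(x⁻¹)² = conj(χ(x²) + χ(x)²)`);
* §2 for `G ≤ Aut M`: **`two_mul_card_mul_finrank_invariants_symmSq_oneFormRep`** ((2.5):
  `2|G|·N = Σ_{x ∈ G} (tr(x²|𝓗¹) + tr(x|𝓗¹)²)`), `two_mul_card_mul_finrank_invariants_altSq_oneFormRep`,
  **`two_mul_card_mul_finrank_invariants_symmSq_oneFormRep_eq_involutions`** ((4.1), first line:
  `2|G|·N = g + g² + |G₀|g + Σ_{x ∈ G₀} tr(x)² + Σ_{x² ≠ 1} (tr(x²) + tr(x)²)`) and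
  **`two_mul_card_mul_finrank_invariants_symmSq_oneFormRep_eq_re`** ((4.1), second line: for any `G₁` with
  `{x : x² ≠ 1} = G₁ ⊔ G₁⁻¹`, `2|G|·N = g + g² + |G₀|g + Σ_{x ∈ G₀} tr(x)² + 2 Σ_{x ∈ G₁} Re(tr(x²) + tr(x)²)`),
  `finrank_invariants_symmSq_oneFormRep_le` (`N ≤ g(g + 1)/2`).

## References

* P. Frediani, A. Ghigi, M. Penegini, *Shimura varieties in the Torelli locus via Galois coverings*, Int. Math.
  Res. Not. IMRN 2015, no. 20, 10595–10623: 1.1, 2.11 (2.4), 2.12 (2.5), (2.6), §4 (4.1) (arXiv:1402.0973 pp. 3,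
  14, 21). [FredianiGhigiPenegini2015]
* G. James, M. Liebeck, *Representations and Characters of Groups*, 2nd ed. (2001), Proposition 19.14.
  [JamesLiebeck2001]
* J.-P. Serre, *Linear Representations of Finite Groups*, GTM 42 (1977), §2.1 Proposition 3, §2.3.
  [SerreLinearRepresentations1977]
-/

noncomputable section

open scoped Manifold ContDiff Topology
open Set Filter Function Complex MulAction Module
open Literature.RepresentationTheory.FiniteGroups

namespace Literature.Geometry.Kaehler

namespace RiemannSurface

/-! ### §1 `2|G|·dim(S²V)^G = Σ_x (χ(x)² + χ(x²))` for any representation -/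

section General

variable {G : Type*} [Group G] [Fintype G] {V : Type*} [AddCommGroup V] [Module ℂ V] [FiniteDimensional ℂ V]
  (ρ : Representation ℂ G V)

/-- **(2.4)–(2.5) for any representation `σ`: `2|G|·dim(S²V)^G = Σ_{x ∈ G} (χ_σ(x)² + χ_σ(x²))`** — the
multiplicity `(χ_{S²σ}, 1) = |G|⁻¹ Σ_x χ_{S²σ}(x)` of the trivial representation in `S²σ`, with
`χ_{S²σ}(x) = ½(χ_σ(x)² + χ_σ(x²))`. [cite: FredianiGhigiPenegini2015, 2.11 (2.4), 2.12 (2.5)]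
[cite: JamesLiebeck2001, Proposition 19.14] -/
theorem two_mul_card_mul_finrank_invariants_symmSq :
    2 * (Nat.card G : ℂ) * finrank ℂ ↥(Representation.symmSq ρ).invariants =
      ∑ x : G, (LinearMap.trace ℂ V (ρ x) ^ 2 + LinearMap.trace ℂ V (ρ (x ^ 2))) := by
  haveI : Invertible (Nat.card G : ℂ) := invertibleOfNonzero (Nat.cast_ne_zero.2 Nat.card_pos.ne')
  have hG : (Nat.card G : ℂ) ≠ 0 := Nat.cast_ne_zero.2 Nat.card_pos.ne'
  have h := Representation.card_inv_mul_sum_char_eq_finrank (Representation.symmSq ρ)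
  rw [← h, ← mul_assoc, mul_assoc 2, mul_inv_cancel₀ hG, mul_one, Finset.mul_sum]
  refine Finset.sum_congr rfl fun x _ ↦ ?_
  rw [Representation.character_symmSq, ← mul_assoc, mul_inv_cancel₀ two_ne_zero, one_mul]
  rfl

/-- `2|G|·dim(Λ²V)^G = Σ_{x ∈ G} (χ_σ(x)² − χ_σ(x²))` (the antisymmetric square, `χ_A = ½(χ² − χ(x²))`).
[cite: JamesLiebeck2001, Proposition 19.14] [cite: FredianiGhigiPenegini2015, 2.11 (2.4)] -/
theorem two_mul_card_mul_finrank_invariants_altSq :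
    2 * (Nat.card G : ℂ) * finrank ℂ ↥(Representation.altSq ρ).invariants =
      ∑ x : G, (LinearMap.trace ℂ V (ρ x) ^ 2 - LinearMap.trace ℂ V (ρ (x ^ 2))) := by
  haveI : Invertible (Nat.card G : ℂ) := invertibleOfNonzero (Nat.cast_ne_zero.2 Nat.card_pos.ne')
  have hG : (Nat.card G : ℂ) ≠ 0 := Nat.cast_ne_zero.2 Nat.card_pos.ne'
  have h := Representation.card_inv_mul_sum_char_eq_finrank (Representation.altSq ρ)
  rw [← h, ← mul_assoc, mul_assoc 2, mul_inv_cancel₀ hG, mul_one, Finset.mul_sum]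
  refine Finset.sum_congr rfl fun x _ ↦ ?_
  rw [Representation.character_altSq, ← mul_assoc, mul_inv_cancel₀ two_ne_zero, one_mul]
  rfl

/-- `|G|·(dim(S²V)^G − dim(Λ²V)^G) = Σ_{x ∈ G} χ_σ(x²)` (difference of the two counts; the Frobenius–Schur sum).
[cite: JamesLiebeck2001, Proposition 19.14] -/
theorem card_mul_finrank_invariants_symmSq_sub_eq :
    (Nat.card G : ℂ) * ((finrank ℂ ↥(Representation.symmSq ρ).invariants : ℂ) -
        finrank ℂ ↥(Representation.altSq ρ).invariants) =
      ∑ x : G, LinearMap.trace ℂ V (ρ (x ^ 2)) := by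
  have hS := two_mul_card_mul_finrank_invariants_symmSq ρ
  have hA := two_mul_card_mul_finrank_invariants_altSq ρ
  have h2 : ∑ x : G, (LinearMap.trace ℂ V (ρ x) ^ 2 + LinearMap.trace ℂ V (ρ (x ^ 2))) -
      ∑ x : G, (LinearMap.trace ℂ V (ρ x) ^ 2 - LinearMap.trace ℂ V (ρ (x ^ 2))) =
      2 * ∑ x : G, LinearMap.trace ℂ V (ρ (x ^ 2)) := by
    rw [← Finset.sum_sub_distrib, Finset.mul_sum]
    exact Finset.sum_congr rfl fun x _ ↦ by ring
  have h3 : 2 * ((Nat.card G : ℂ) * ((finrank ℂ ↥(Representation.symmSq ρ).invariants : ℂ) -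
      finrank ℂ ↥(Representation.altSq ρ).invariants)) = 2 * ∑ x : G, LinearMap.trace ℂ V (ρ (x ^ 2)) := by
    rw [← h2, ← hS, ← hA]; ring
  exact mul_left_cancel₀ two_ne_zero h3

/-- **`χ(x⁻²) + χ(x⁻¹)² = conj(χ(x²) + χ(x)²)`** — the summand of (2.5) at `x⁻¹` is the conjugate of the summand at
`x` («`Σ_{x ∈ G₁} (χ_ρ(x⁻²) + χ_ρ(x⁻¹)²)` … `= … Re(χ_ρ(x²) + χ_ρ(x)²)`»). [cite: FredianiGhigiPenegini2015, §4 (4.1)] -/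
theorem trace_sq_add_trace_sq_inv (x : G) :
    LinearMap.trace ℂ V (ρ x⁻¹) ^ 2 + LinearMap.trace ℂ V (ρ (x⁻¹ ^ 2)) =
      starRingEnd ℂ (LinearMap.trace ℂ V (ρ x) ^ 2 + LinearMap.trace ℂ V (ρ (x ^ 2))) := by
  rw [map_add, RingHom.map_pow (starRingEnd ℂ), ← trace_inv_eq_conj_trace ρ x, inv_pow,
    ← trace_inv_eq_conj_trace ρ (x ^ 2)]

end General

/-! ### §2 `N = dim(S²𝓗¹(M))^G` -/

section OneForms

variable {M : Type*} [TopologicalSpace M] [ChartedSpace ℂ M] [IsManifold 𝓘(ℂ, ℂ) ω M]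
  [CompactSpace M] [T2Space M] [PreconnectedSpace M] [Nonempty M] (G : Subgroup (autGroup M))

/-- **(2.5): `2|G|·N = Σ_{x ∈ G} (χ_ρ(x)² + χ_ρ(x²))`, `N = dim(S²𝓗¹(M))^G`**, `χ_ρ(x) = tr(x|𝓗¹(M))`, for a
finite group `G ≤ Aut M` of a compact Riemann surface. [cite: FredianiGhigiPenegini2015, 2.12 (2.5)] -/
theorem two_mul_card_mul_finrank_invariants_symmSq_oneFormRep [Fintype ↥G] :
    2 * (Nat.card ↥G : ℂ) * finrank ℂ ↥(Representation.invariants (Representation.symmSq ((oneFormRep M).comp G.subtype))) =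
      ∑ x : ↥G, (LinearMap.trace ℂ ↥(holomorphicOneForms M) (oneFormRep M (x : autGroup M)) ^ 2 +
        LinearMap.trace ℂ ↥(holomorphicOneForms M) (oneFormRep M ((x ^ 2 : ↥G) : autGroup M))) := by
  haveI : Module.Finite ℂ ↥(holomorphicOneForms M) := moduleFinite_holomorphicOneForms
  exact two_mul_card_mul_finrank_invariants_symmSq ((oneFormRep M).comp G.subtype)

/-- `2|G|·dim(Λ²𝓗¹(M))^G = Σ_{x ∈ G} (χ_ρ(x)² − χ_ρ(x²))` (the antisymmetric square of `𝓗¹(M)`).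
[cite: FredianiGhigiPenegini2015, 2.11 (2.4)] [cite: JamesLiebeck2001, Proposition 19.14] -/
theorem two_mul_card_mul_finrank_invariants_altSq_oneFormRep [Fintype ↥G] :
    2 * (Nat.card ↥G : ℂ) * finrank ℂ ↥(Representation.invariants (Representation.altSq ((oneFormRep M).comp G.subtype))) =
      ∑ x : ↥G, (LinearMap.trace ℂ ↥(holomorphicOneForms M) (oneFormRep M (x : autGroup M)) ^ 2 -
        LinearMap.trace ℂ ↥(holomorphicOneForms M) (oneFormRep M ((x ^ 2 : ↥G) : autGroup M))) := by
  haveI : Module.Finite ℂ ↥(holomorphicOneForms M) := moduleFinite_holomorphicOneForms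
  exact two_mul_card_mul_finrank_invariants_altSq ((oneFormRep M).comp G.subtype)

/-- **(4.1), first form: `2|G|·N = g + g² + |G₀|·g + Σ_{x ∈ G₀} χ_ρ(x)² + Σ_{x : x² ≠ 1} (χ_ρ(x²) + χ_ρ(x)²)`**,
`G₀` the elements of order `2` (for `x ∈ G₀`, `χ_ρ(x²) = χ_ρ(1) = g`; the identity contributes `g² + g`).
[cite: FredianiGhigiPenegini2015, §4 (4.1)] -/
theorem two_mul_card_mul_finrank_invariants_symmSq_oneFormRep_eq_involutions [Fintype ↥G] [DecidableEq ↥G] :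
    2 * (Nat.card ↥G : ℂ) * finrank ℂ ↥(Representation.invariants (Representation.symmSq ((oneFormRep M).comp G.subtype))) =
      (arithGenus M : ℂ) + (arithGenus M : ℂ) ^ 2 +
        ((Finset.univ.filter fun x : ↥G ↦ x ≠ 1 ∧ x ^ 2 = 1).card : ℂ) * arithGenus M +
        ∑ x ∈ Finset.univ.filter (fun x : ↥G ↦ x ≠ 1 ∧ x ^ 2 = 1),
          LinearMap.trace ℂ ↥(holomorphicOneForms M) (oneFormRep M (x : autGroup M)) ^ 2 +
        ∑ x ∈ Finset.univ.filter (fun x : ↥G ↦ x ^ 2 ≠ 1),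
          (LinearMap.trace ℂ ↥(holomorphicOneForms M) (oneFormRep M (x : autGroup M)) ^ 2 +
            LinearMap.trace ℂ ↥(holomorphicOneForms M) (oneFormRep M ((x ^ 2 : ↥G) : autGroup M))) := by
  haveI : Module.Finite ℂ ↥(holomorphicOneForms M) := moduleFinite_holomorphicOneForms
  rw [two_mul_card_mul_finrank_invariants_symmSq_oneFormRep]
  set f : ↥G → ℂ := fun x ↦ LinearMap.trace ℂ ↥(holomorphicOneForms M) (oneFormRep M (x : autGroup M)) ^ 2 +
    LinearMap.trace ℂ ↥(holomorphicOneForms M) (oneFormRep M ((x ^ 2 : ↥G) : autGroup M)) with hf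
  have hg : LinearMap.trace ℂ ↥(holomorphicOneForms M) (oneFormRep M ((1 : ↥G) : autGroup M)) = arithGenus M := by
    rw [OneMemClass.coe_one, map_one, LinearMap.trace_one, finrank_holomorphicOneForms_eq_arithGenus]
  -- split `G = {x : x² = 1} ⊔ {x : x² ≠ 1}` and `{x : x² = 1} = {1} ⊔ G₀`
  rw [← Finset.sum_filter_add_sum_filter_not Finset.univ (fun x : ↥G ↦ x ^ 2 = 1)]
  have hsplit : Finset.univ.filter (fun x : ↥G ↦ x ^ 2 = 1) =
      insert 1 (Finset.univ.filter fun x : ↥G ↦ x ≠ 1 ∧ x ^ 2 = 1) := by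
    ext x
    simp only [Finset.mem_filter, Finset.mem_univ, true_and, Finset.mem_insert]
    constructor
    · intro hx; by_cases h1 : x = 1; exacts [Or.inl h1, Or.inr ⟨h1, hx⟩]
    · rintro (rfl | ⟨-, hx⟩); exacts [one_pow 2, hx]
  have h1n : (1 : ↥G) ∉ Finset.univ.filter (fun x : ↥G ↦ x ≠ 1 ∧ x ^ 2 = 1) := by simp
  rw [hsplit, Finset.sum_insert h1n]
  have h0 : ∀ x ∈ Finset.univ.filter (fun x : ↥G ↦ x ≠ 1 ∧ x ^ 2 = 1),
      f x = LinearMap.trace ℂ ↥(holomorphicOneForms M) (oneFormRep M (x : autGroup M)) ^ 2 + arithGenus M := by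
    intro x hx
    rw [hf]
    simp only [(Finset.mem_filter.1 hx).2.2, hg]
  rw [Finset.sum_congr rfl h0, Finset.sum_add_distrib, Finset.sum_const, nsmul_eq_mul]
  simp only [hf, one_pow, hg]
  ring

/-- **(4.1), second form**: with `G₀` the involutions and ANY `G₁` splitting the elements of order `> 2` as
`G₁ ⊔ G₁⁻¹`, `2|G|·N = g + g² + |G₀|g + Σ_{x ∈ G₀} χ_ρ(x)² + 2 Σ_{x ∈ G₁} Re(χ_ρ(x²) + χ_ρ(x)²)` (the terms at
`x⁻¹` are the conjugates of the terms at `x`). [cite: FredianiGhigiPenegini2015, §4 (4.1)] -/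
theorem two_mul_card_mul_finrank_invariants_symmSq_oneFormRep_eq_re [Fintype ↥G] [DecidableEq ↥G]
    (G₁ : Finset ↥G) (hdisj : Disjoint G₁ (G₁.image fun x ↦ x⁻¹))
    (hcover : G₁ ∪ G₁.image (fun x ↦ x⁻¹) = Finset.univ.filter (fun x : ↥G ↦ x ^ 2 ≠ 1)) :
    2 * (Nat.card ↥G : ℂ) * finrank ℂ ↥(Representation.invariants (Representation.symmSq ((oneFormRep M).comp G.subtype))) =
      (arithGenus M : ℂ) + (arithGenus M : ℂ) ^ 2 +
        ((Finset.univ.filter fun x : ↥G ↦ x ≠ 1 ∧ x ^ 2 = 1).card : ℂ) * arithGenus M +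
        ∑ x ∈ Finset.univ.filter (fun x : ↥G ↦ x ≠ 1 ∧ x ^ 2 = 1),
          LinearMap.trace ℂ ↥(holomorphicOneForms M) (oneFormRep M (x : autGroup M)) ^ 2 +
        2 * ∑ x ∈ G₁, ((LinearMap.trace ℂ ↥(holomorphicOneForms M) (oneFormRep M (x : autGroup M)) ^ 2 +
            LinearMap.trace ℂ ↥(holomorphicOneForms M) (oneFormRep M ((x ^ 2 : ↥G) : autGroup M))).re : ℂ) := by
  haveI : Module.Finite ℂ ↥(holomorphicOneForms M) := moduleFinite_holomorphicOneForms
  rw [two_mul_card_mul_finrank_invariants_symmSq_oneFormRep_eq_involutions]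
  congr 1
  set f : ↥G → ℂ := fun x ↦ LinearMap.trace ℂ ↥(holomorphicOneForms M) (oneFormRep M (x : autGroup M)) ^ 2 +
    LinearMap.trace ℂ ↥(holomorphicOneForms M) (oneFormRep M ((x ^ 2 : ↥G) : autGroup M)) with hf
  have hfinv : ∀ x : ↥G, f x⁻¹ = starRingEnd ℂ (f x) := fun x ↦ by
    simp only [hf]
    exact trace_sq_add_trace_sq_inv ((oneFormRep M).comp G.subtype) x
  -- `x ↦ x⁻¹` is injective on `G₁`
  have hinj : Set.InjOn (fun x : ↥G ↦ x⁻¹) ↑G₁ := fun a _ b _ h ↦ inv_injective h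
  change ∑ x ∈ Finset.univ.filter (fun x : ↥G ↦ x ^ 2 ≠ 1), f x = 2 * ∑ x ∈ G₁, ((f x).re : ℂ)
  rw [← hcover, Finset.sum_union hdisj, Finset.sum_image hinj, ← Finset.sum_add_distrib, Finset.mul_sum]
  refine Finset.sum_congr rfl fun x _ ↦ ?_
  rw [hfinv, Complex.add_conj, Complex.ofReal_mul, Complex.ofReal_ofNat]

/-- `N ≤ g(g + 1)/2 = dim S²𝓗¹(M)`. [cite: FredianiGhigiPenegini2015, 1.1] [cite: JamesLiebeck2001, Proposition 19.13] -/
theorem finrank_invariants_symmSq_oneFormRep_le :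
    finrank ℂ ↥(Representation.invariants (Representation.symmSq ((oneFormRep M).comp G.subtype))) ≤
      arithGenus M * (arithGenus M + 1) / 2 := by
  haveI : Module.Finite ℂ ↥(holomorphicOneForms M) := moduleFinite_holomorphicOneForms
  rw [← finrank_holomorphicOneForms_eq_arithGenus (M := M), ← finrank_symmetricTensors (k := ℂ)]
  exact Submodule.finrank_le _

end OneForms

end RiemannSurface

end Literature.Geometry.Kaehler
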